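import Mathlib.Analysis.SpecialFunctions.Pow.Real
import HarnessLib

/-!
# Route `AnisotropyChord`: THEOREM R wrapper — from the three class equations of the weighted rook
# graph to a physical point of the quotient

Dictionary between the two-magnon eigen-equation of the bond-weighted ferromagnetic XXZ
Hamiltonian on the rook graph `K_{p+1} □ K_{q+1}` (row bonds `J₁ > 0`, column bonds `J₂ > 0`,
couplings `w = −J` in `xxzHamiltonianWith`) restricted to a class-constant vector — values `A` on row
pairs, `B` on column pairs, `C` on far pairs, eigenvalue `E`, `Z₀ = ¼Σ_e w_e + (pJ₁ + qJ₂)` — and the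
normalised three-class quotient of the theory seat (THEOREM R, ROTOR-THEORY-5 §41) used by the
tree's real-algebra form `wrook_flatOverlap_antitone_all`:
`u = A/C`, `v = B/C`, `J = J₂/J₁`, `σ = 1 − Δ`, `E' = (1 − v) + J(1 − u)`, and then
(E1) `u(Jq + σ − E') = Jq`, (E2) `v(p + σJ − E') = p`, (E3) by definition; moreover `u, v > 0` as
soon as `A, B ≥ 0 < C` (Perron sign pattern).  The three class equations are
`E A = Δ(Z₀ − J₁)A − (J₁(p−1)A + J₂ q C)`, `E B = Δ(Z₀ − J₂)B − (J₂(q−1)B + J₁ p C)`,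
`E C = Δ Z₀ C − (J₂ A + J₁ B + (J₁(p−1) + J₂(q−1))C)` (for `J₁ = J₂ = 1` these are
`rook_eigen_relations`).  Pure field algebra; no definition is introduced.
-/

set_option linter.dupNamespace false

namespace Summit.HubbardSuperconductivity.HubbardSuperconductivity.Theorems.AnisotropyChord.TwoMagnon

/-- **Class equations ⇒ physical point.**  From the three class equations of the weighted rook
two-magnon problem (see the module docstring) with `J₁ > 0`, `C ≠ 0`, the normalised class values
`u = A/C`, `v = B/C` satisfy the quotient eigen-equations (E1)–(E3) of THEOREM R with coupling ratio
`J = J₂/J₁`, coupling `σ = 1 − Δ` and quotient energy `E' = (1 − v) + J(1 − u)`. [folklore] -/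
theorem wrook_point_of_classes {J₁ J₂ Δ Z₀ E A B C p q : ℝ} (hJ₁ : 0 < J₁) (hC : C ≠ 0)
    (hrow : E * A = Δ * (Z₀ - J₁) * A - (J₁ * (p - 1) * A + J₂ * q * C))
    (hcol : E * B = Δ * (Z₀ - J₂) * B - (J₂ * (q - 1) * B + J₁ * p * C))
    (hfar : E * C = Δ * Z₀ * C - (J₂ * A + J₁ * B + (J₁ * (p - 1) + J₂ * (q - 1)) * C)) :
    (A / C) * ((J₂ / J₁) * q + (1 - Δ) - ((1 - B / C) + (J₂ / J₁) * (1 - A / C))) = (J₂ / J₁) * q ∧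
    (B / C) * (p + (1 - Δ) * (J₂ / J₁) - ((1 - B / C) + (J₂ / J₁) * (1 - A / C))) = p := by
  have hJ0 : J₁ ≠ 0 := hJ₁.ne'
  -- eliminate `E` and `Z₀`
  have k1 : A * (J₂ * A + J₁ * B + J₂ * (q - 1) * C - Δ * J₁ * C) = J₂ * q * C ^ 2 := by
    linear_combination A * hfar - C * hrow
  have k2 : B * (J₂ * A + J₁ * B + J₁ * (p - 1) * C - Δ * J₂ * C) = J₁ * p * C ^ 2 := by
    linear_combination B * hfar - C * hcol
  constructor
  · field_simp
    linear_combination k1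
  · field_simp
    linear_combination k2

/-- **Perron sign pattern ⇒ positive class values.**  If in addition `A, B ≥ 0 < C`, `J₂ > 0`,
`p, q > 0`, then `u = A/C > 0` and `v = B/C > 0` (from (E1), (E2): `u·(…) = Jq > 0`,
`v·(…) = p > 0`). [folklore] -/
theorem wrook_classes_pos {J₁ J₂ Δ Z₀ E A B C p q : ℝ} (hJ₁ : 0 < J₁) (hJ₂ : 0 < J₂)
    (hp : 0 < p) (hq : 0 < q) (hA : 0 ≤ A) (hB : 0 ≤ B) (hC : 0 < C)
    (hrow : E * A = Δ * (Z₀ - J₁) * A - (J₁ * (p - 1) * A + J₂ * q * C))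
    (hcol : E * B = Δ * (Z₀ - J₂) * B - (J₂ * (q - 1) * B + J₁ * p * C))
    (hfar : E * C = Δ * Z₀ * C - (J₂ * A + J₁ * B + (J₁ * (p - 1) + J₂ * (q - 1)) * C)) :
    0 < A / C ∧ 0 < B / C := by
  obtain ⟨e1, e2⟩ := wrook_point_of_classes hJ₁ hC.ne' hrow hcol hfar
  have hu0 : 0 ≤ A / C := div_nonneg hA hC.le
  have hv0 : 0 ≤ B / C := div_nonneg hB hC.le
  have hJ : 0 < J₂ / J₁ := div_pos hJ₂ hJ₁
  refine ⟨lt_of_le_of_ne hu0 ?_, lt_of_le_of_ne hv0 ?_⟩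
  · intro h
    rw [← h, zero_mul] at e1
    have : 0 < J₂ / J₁ * q := mul_pos hJ hq
    linarith
  · intro h
    rw [← h, zero_mul] at e2
    linarith

/-- **Far class cannot vanish.**  If `A, B ≥ 0`, `C ≥ 0`, `J₁, J₂ > 0` and the far-class
equation holds with `C = 0`, then `A = B = 0` — so a nonzero nonnegative class-constant solution has
`C > 0`. [folklore] -/
theorem wrook_far_ne_zero {J₁ J₂ Δ Z₀ E A B C p q : ℝ} (hJ₁ : 0 < J₁) (hJ₂ : 0 < J₂)
    (hA : 0 ≤ A) (hB : 0 ≤ B) (hC0 : C = 0)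
    (hfar : E * C = Δ * Z₀ * C - (J₂ * A + J₁ * B + (J₁ * (p - 1) + J₂ * (q - 1)) * C)) :
    A = 0 ∧ B = 0 := by
  subst hC0
  have h : J₂ * A + J₁ * B = 0 := by linarith
  have h1 : 0 ≤ J₂ * A := mul_nonneg hJ₂.le hA
  have h2 : 0 ≤ J₁ * B := mul_nonneg hJ₁.le hB
  constructor
  · nlinarith [mul_pos hJ₂ hJ₁]
  · nlinarith [mul_pos hJ₂ hJ₁]

end Summit.HubbardSuperconductivity.HubbardSuperconductivity.Theorems.AnisotropyChord.TwoMagnon
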